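import Mathlib
import HarnessLib.Audit
import Summits.PneNP.PneNP.Theorems.PstarGateRegime

/-!
# One GATED chord: the UNGATED companion system (the clean pair `(R + ℓ, w₂)`) is infeasible, and in CASE P chord-minimal wherever the original is (prover-1 g18)

FRONTIER range-avoidance ladder, rung F-N3 (`stmt-PneNP-19007`), cell `pnp-ideate` (this seat's `HOME/pnp-ideate-prover-1/g18/E2-PLAN.md` §0, §3 (P3));
restricted-model proof complexity — nothing here bears on `P` versus `NP`.

Model layer.  For a chord system `S` and a distinguished chord `e` whose second private is unread (`ρ'_e ≡ 0`; the E2 gate reads the first private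
with the base-dependent vector `ρ_e(a) = (ℓ(a), 0)`), the UNGATED COMPANION `ungate S e` forgets the reads of `e` and moves `ρ_e(a)` into the state-free
part — in the instance: the clean pair `pair₀ = (R + ℓ, w₂)` of the memo, whose first member no longer touches the private `p`.

* `val_ungate` — its value at any state is the value of `S` at the same state with `e` switched to `(1, u_e(a))` (an ADMISSIBLE state of `e` whose
  first private is on);
* `infeasible_ungate` — hence **`S` infeasible ⟹ `ungate S e` infeasible** (T3 for `pair₀`, memo §0);
* `chordMinimal_ungate` — a chord-minimality witness `(a, s)` of `S` for `i ≠ e` at which `e` is unread or has its first private on is a witness for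
  `ungate S e`;
* `chordMinimal_ungate_of_singleRead` — **in CASE P (single-read at the witness point) this is automatic**: the witness lies on `Z`, where a read
  gated chord is forced ON (`PstarGateRegime.forced_of_singleRead_at`) — so every other chord that is chord-minimal for `S` is chord-minimal for the
  companion (memo §3 (P2): "chords have no corner witnesses in CASE P").
Since the companion has CONSTANT reads when the other chords do, the clean model chain (`direction_collapse`, `star_star`, …) applies to it.
-/

set_option linter.dupNamespace false -- `Summit.PneNP.PneNP.…`: summit = sub-problem name (D-0017 single-conjunct layout)

open Finset
open Summit.PneNP.PneNP.Theorems.PstarReadSumset (V2)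
open Summit.PneNP.PneNP.Theorems.PstarChordSystem (ChordSystem)
open Summit.PneNP.PneNP.Theorems.PstarGateRegime (forced_of_singleRead_at)

namespace Summit.PneNP.PneNP.Theorems.PstarGateUngate

variable {ι A : Type*} [DecidableEq ι] (S : ChordSystem ι A)

/-- Every element of `𝔽₂` is `0` or `1`. -/
private theorem zmod2_cases (t : ZMod 2) : t = 0 ∨ t = 1 := by
  revert t; decide

/-- **The ungated companion**: `e` reads nothing; its former first read joins the state-free part. -/
def ungate (e : ι) : ChordSystem ι A where
  u := S.u
  ρ i a := if i = e then 0 else S.ρ i a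
  ρ' i a := if i = e then 0 else S.ρ' i a
  F a := S.F a + S.ρ e a
  t := S.t

/-- Unfolding. -/
@[simp] theorem ungate_u (e : ι) : (ungate S e).u = S.u := rfl
/-- Unfolding. -/
@[simp] theorem ungate_t (e : ι) : (ungate S e).t = S.t := rfl
/-- Unfolding. -/
@[simp] theorem ungate_F (e : ι) (a : A) : (ungate S e).F a = S.F a + S.ρ e a := rfl
/-- Unfolding: the other chords keep their reads. -/
theorem ungate_ρ_of_ne {e i : ι} (h : i ≠ e) (a : A) : (ungate S e).ρ i a = S.ρ i a ∧ (ungate S e).ρ' i a = S.ρ' i a :=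
  ⟨if_neg h, if_neg h⟩
/-- Unfolding: `e` reads nothing. -/
theorem ungate_ρ_self (e : ι) (a : A) : (ungate S e).ρ e a = 0 ∧ (ungate S e).ρ' e a = 0 := ⟨if_pos rfl, if_pos rfl⟩

/-- Admissibility is unchanged. -/
theorem adm_ungate_iff (e : ι) (E : Finset ι) (a : A) (s : ι → ZMod 2 × ZMod 2) : (ungate S e).Adm E a s ↔ S.Adm E a s := Iff.rfl

/-- The state of `e` with its first private on and the product right: `(1, u_e(a))`. -/
def onState (e : ι) (a : A) : ZMod 2 × ZMod 2 := (1, S.u e a)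

omit [DecidableEq ι] in
/-- `onState` is admissible for `e`. -/
theorem onState_adm (e : ι) (a : A) : (onState S e a).1 * (onState S e a).2 = S.u e a := by
  unfold onState; rw [one_mul]

/-- **The companion's value** at `s` is the value of `S` at `s` with `e` switched to `onState` (second private of `e` unread). -/
theorem val_ungate {E : Finset ι} {e : ι} (he : e ∈ E) (hρ' : ∀ a, S.ρ' e a = 0) (a : A) (s : ι → ZMod 2 × ZMod 2) :
    (ungate S e).val E a s = S.val E a (Function.update s e (onState S e a)) := by
  rw [(ungate S e).val_eq he, S.val_eq he, S.val_erase_update, S.contrib_update_self]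
  unfold ChordSystem.contrib onState
  rw [(ungate_ρ_self S e a).1, (ungate_ρ_self S e a).2, smul_zero, smul_zero, add_zero, zero_add, hρ', smul_zero, add_zero, one_smul]
  -- the sums over `E.erase e` agree
  have hsum : (ungate S e).val (E.erase e) a s = S.val (E.erase e) a s + S.ρ e a := by
    unfold ChordSystem.val
    rw [ungate_F]
    have h : ∀ i ∈ E.erase e, (ungate S e).contrib a s i = S.contrib a s i := fun i hi => by
      unfold ChordSystem.contrib
      rw [(ungate_ρ_of_ne S (ne_of_mem_erase hi) a).1, (ungate_ρ_of_ne S (ne_of_mem_erase hi) a).2]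
    rw [sum_congr rfl h]
    abel
  rw [hsum]
  abel

/-- **`S` infeasible ⟹ the companion infeasible.** -/
theorem infeasible_ungate {E : Finset ι} (hI : S.Infeasible E) {e : ι} (he : e ∈ E) (hρ' : ∀ a, S.ρ' e a = 0) : (ungate S e).Infeasible E := by
  intro a s hadm hval
  rw [val_ungate S he hρ'] at hval
  exact hI a _ (S.adm_update (S.adm_erase hadm e) (onState_adm S e a)) hval

/-- **Chord-minimality transfers at a witness where `e` is unread or has its first private on.** -/
theorem chordMinimal_ungate {E : Finset ι} {e i : ι} (he : e ∈ E) (hρ' : ∀ a, S.ρ' e a = 0) {a : A} {s : ι → ZMod 2 × ZMod 2}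
    (hadm : S.Adm (E.erase i) a s) (hval : S.val E a s = S.t) (hon : S.ρ e a = 0 ∨ (s e).1 = 1) : (ungate S e).ChordMinimal E i := by
  refine ⟨a, s, (adm_ungate_iff S e _ a s).2 hadm, ?_⟩
  rw [val_ungate S he hρ', ungate_t, ← hval]
  -- the two states of `e` give the same contribution
  rw [S.val_eq he, S.val_eq he a s, S.val_erase_update, S.contrib_update_self]
  unfold ChordSystem.contrib onState
  rw [hρ', smul_zero, smul_zero, add_zero, add_zero, one_smul]
  rcases hon with h0 | h1
  · rw [h0, smul_zero]
  · rw [h1, one_smul]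

/-- **CASE P: chord-minimality transfers for free.**  If `S` is infeasible and single-read at the witness point of a chord-minimality witness of
`i ≠ e`, the companion is chord-minimal in `i`: at the witness `e` is unread or (being read on `Z`) forced ON, so its first private is on. -/
theorem chordMinimal_ungate_of_singleRead {E : Finset ι} (hI : S.Infeasible E) {e i : ι} (he : e ∈ E) (hie : i ≠ e)
    (hρ' : ∀ a, S.ρ' e a = 0) {a : A} {s : ι → ZMod 2 × ZMod 2} (hadm : S.Adm (E.erase i) a s) (hval : S.val E a s = S.t)
    (hS : ∀ k ∈ E, (S.ρ k a).2 = 0 ∧ (S.ρ' k a).2 = 0) : (ungate S e).ChordMinimal E i := by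
  refine chordMinimal_ungate S he hρ' hadm hval ?_
  by_cases h0 : S.ρ e a = 0
  · exact Or.inl h0
  right
  -- the witness lies on `Z`: the second coordinate is state-free
  have hZ : (S.F a).2 = S.t.2 := by
    have h := congrArg Prod.snd hval
    unfold ChordSystem.val at h
    rw [Prod.snd_add, Prod.snd_sum] at h
    have h00 : ∑ k ∈ E, (S.contrib a s k).2 = 0 := sum_eq_zero fun k hk => by
      unfold ChordSystem.contrib
      rw [Prod.snd_add, Prod.smul_snd, Prod.smul_snd, (hS k hk).1, (hS k hk).2, smul_zero, smul_zero, add_zero]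
    rw [h00, add_zero] at h
    exact h
  have hu : S.u e a = 1 := forced_of_singleRead_at S hI hS hZ he (Or.inl h0)
  -- `e` is admissible at the witness (only `i` is dropped): `(s e).1 (s e).2 = 1`
  have hse : (s e).1 * (s e).2 = 1 := by rw [hadm e (mem_erase.2 ⟨hie.symm, he⟩), hu]
  rcases zmod2_cases ((s e).1) with h | h
  · rw [h, zero_mul] at hse; exact absurd hse (by decide)
  · exact h

/-- The companion has constant reads if the chords other than `e` do. -/
theorem const_ungate {E : Finset ι} {e : ι} (hconst : ∀ i ∈ E, i ≠ e → ∀ a a', S.ρ i a = S.ρ i a' ∧ S.ρ' i a = S.ρ' i a') :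
    ∀ i ∈ E, ∀ a a', (ungate S e).ρ i a = (ungate S e).ρ i a' ∧ (ungate S e).ρ' i a = (ungate S e).ρ' i a' := by
  intro i hi a a'
  by_cases hie : i = e
  · subst hie
    rw [(ungate_ρ_self S i a).1, (ungate_ρ_self S i a).2, (ungate_ρ_self S i a').1, (ungate_ρ_self S i a').2]
    exact ⟨rfl, rfl⟩
  · rw [(ungate_ρ_of_ne S hie a).1, (ungate_ρ_of_ne S hie a).2, (ungate_ρ_of_ne S hie a').1, (ungate_ρ_of_ne S hie a').2]
    exact hconst i hi hie a a'

end Summit.PneNP.PneNP.Theorems.PstarGateUngate
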